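import Summits.Ventures.PercRepro.C041TriangleMarkedSmall
import Summits.Ventures.PercRepro.C041TriangleStar2Star2
import Summits.Ventures.PercRepro.C041TriangleStar2Star2Mark
import Summits.Ventures.PercRepro.C041TriangleStar2MarkStar2Mark
import Summits.Ventures.PercRepro.C041TriangleStar2MarkStar2Mark0

/-!
# THE TRIANGLE ON TWO TWO-LEAF STARS WITH ARBITRARY MARKS (mine-3, gen 67; C-041.md §21 (bg))

The nine seeds of `InCone_thetaTri_marks_of_seeds_pair` for `w = v a * v b`, `w′ = v c * v d`: THEOREM (TWO-LEAF STAR ×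
TWO-LEAF STAR) and the three kit certificates `InCone_thetaTri_star2Star2Mark` (`θ_△(v a v b, v c v d · v 1)`),
`InCone_thetaTri_star2MarkStar2Mark` (`θ_△(v a v b · v 1, v c v d · v 1)`), `InCone_thetaTri_star2MarkStar2Mark0`
(`θ_△(v a v b · v 1, v c v d · v 0)`), with the symmetry `thetaTri_comm` and the mirrors under `sw`.  THEOREM
`InCone_thetaTri_star2Marks_star2Marks`: `θ_△(v a v b · X(p,q), v c v d · X(p′,q′)) ∈ cone` for all marks — every pair of
stars with at most two INTERIOR leaves each is settled, whatever the marks.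
-/

namespace PercRepro

namespace RelaxedTriangle

open TreeClosure

/-- The mirror of `θ_△(v a v b, v c v d · v 1)`: the 2-mark. -/
theorem InCone_thetaTri_star2Star2Mark0 (a b c d : ℝ) (ha : 0 ≤ a ∧ a ≤ 1) (hb : 0 ≤ b ∧ b ≤ 1) (hc : 0 ≤ c ∧ c ≤ 1)
    (hd : 0 ≤ d ∧ d ≤ 1) : InCone (thetaTri (v a * v b) (v c * v d * v 0)) := by
  have h := InCone_thetaTri_star2Star2Mark (1 - a) (1 - b) (1 - c) (1 - d) ⟨by linarith [ha.2], by linarith [ha.1]⟩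
    ⟨by linarith [hb.2], by linarith [hb.1]⟩ ⟨by linarith [hc.2], by linarith [hc.1]⟩ ⟨by linarith [hd.2], by linarith [hd.1]⟩
  rw [← InCone_thetaTri_sw_iff] at h
  simp only [sw_mul, sw_v] at h
  simpa using h

/-- The mirror of `θ_△(v a v b · v 1, v c v d · v 1)`: two 2-marks. -/
theorem InCone_thetaTri_star2Mark0Star2Mark0 (a b c d : ℝ) (ha : 0 ≤ a ∧ a ≤ 1) (hb : 0 ≤ b ∧ b ≤ 1)
    (hc : 0 ≤ c ∧ c ≤ 1) (hd : 0 ≤ d ∧ d ≤ 1) : InCone (thetaTri (v a * v b * v 0) (v c * v d * v 0)) := by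
  have h := InCone_thetaTri_star2MarkStar2Mark (1 - a) (1 - b) (1 - c) (1 - d) ⟨by linarith [ha.2], by linarith [ha.1]⟩
    ⟨by linarith [hb.2], by linarith [hb.1]⟩ ⟨by linarith [hc.2], by linarith [hc.1]⟩ ⟨by linarith [hd.2], by linarith [hd.1]⟩
  rw [← InCone_thetaTri_sw_iff] at h
  simp only [sw_mul, sw_v] at h
  simpa using h

/-- **THEOREM (TWO TWO-LEAF STARS WITH ANY MARKS)**: `θ_△(v a v b · X(p,q), v c v d · X(p′,q′)) ∈ cone`. -/
theorem InCone_thetaTri_star2Marks_star2Marks (a b c d : ℝ) (ha : 0 ≤ a ∧ a ≤ 1) (hb : 0 ≤ b ∧ b ≤ 1)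
    (hc : 0 ≤ c ∧ c ≤ 1) (hd : 0 ≤ d ∧ d ≤ 1) (p q p' q' : ℕ) :
    InCone (thetaTri (v a * v b * (v 1 ^ p * v 0 ^ q)) (v c * v d * (v 1 ^ p' * v 0 ^ q'))) := by
  refine InCone_thetaTri_marks_of_seeds_pair ((InCone_v a ha).mul (InCone_v b hb)) ((InCone_v c hc).mul (InCone_v d hd))
    (InCone_thetaTri_star2Star2 a b c d ha hb hc hd) (InCone_thetaTri_star2Star2Mark a b c d ha hb hc hd)
    (InCone_thetaTri_star2Star2Mark0 a b c d ha hb hc hd) ?_ ?_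
    (InCone_thetaTri_star2MarkStar2Mark a b c d ha hb hc hd) (InCone_thetaTri_star2MarkStar2Mark0 a b c d ha hb hc hd)
    ?_ (InCone_thetaTri_star2Mark0Star2Mark0 a b c d ha hb hc hd) p q p' q'
  · rw [thetaTri_comm]; exact InCone_thetaTri_star2Star2Mark c d a b hc hd ha hb
  · rw [thetaTri_comm]; exact InCone_thetaTri_star2Star2Mark0 c d a b hc hd ha hb
  · rw [thetaTri_comm]; exact InCone_thetaTri_star2MarkStar2Mark0 c d a b hc hd ha hb

end RelaxedTriangle

end PercRepro
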